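import Literature.Topology.FourManifolds.HalfSpaceChartedEmbedding
import Literature.Topology.FourManifolds.InteriorDiscs
import Literature.Topology.FourManifolds.ConnectedSumData
import Literature.Topology.FourManifolds.SmoothEmbeddingCriteria
import HarnessLib

/-!
# Connected sum of a manifold with boundary and a boundaryless manifold along interior discs

Topic `Literature/Topology/FourManifolds` (general differential-topology vocabulary; requested by
the review of the fact `Literature.Barriers.SmoothPoincare4.kang2022_akbulutRubermanStabilised`,
whose statement quantifies over the tree's relational connected sums
`IsConnectedSum (𝓡∂ 4) (𝓡∂ 4) ((𝓡 2).prod (𝓡 2)) V (S² × S²) P` of a 4-manifold WITH boundary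
`V` and the closed manifold `S² × S²`, for which the tree had no existence theorem: its
`exists_isConnectedSum_holds` (`ConnectedSumExistence.lean`) is for two closed manifolds charted on
`ℝⁿ`).

Kervaire–Milnor, *Groups of homotopy spheres I*, Ann. of Math. 77 (1963), §2, and Kosinski,
*Differential Manifolds* (1993), VI.1, define `M₁ # M₂` for manifolds with boundary by removing the
centres of two discs `h₁ : Rᵐ → Int M₁`, `h₂ : Rᵐ → Int M₂` and identifying the punctured discs
along `t • u ↦ (1 - t) • u`; "if `M₁`, `M₂` have boundary, `∂(M₁ # M₂) = ∂M₁ ⊔ ∂M₂`". This file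
carries the construction out, in the tree's witness style and with the tree's gluing of half-space
charted pieces (`GluingConstructionBoundary.lean`), for

* an `(m+1)`-manifold with boundary `M` (charted on `ℍᵐ⁺¹`, model `𝓡∂ (m + 1)`) with a disc
  `i : ℝᵐ⁺¹ → M` (a smooth embedding of the model vector space; it lands in the interior,
  `isInteriorPoint_of_isSmoothEmbedding_disc`), and
* a boundaryless manifold `Y` charted on an ARBITRARY boundaryless model `IY` (e.g. the product
  model of `S² × S²`) whose model vector space is identified with `ℝᵐ⁺¹` by `L`, with a disc
  `j : ℝᵐ⁺¹ → Y`,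

packaged as `Literature.Topology.FourManifolds.InteriorSumData m M IY Y`.

## Main definitions and results (everything is proved; no named facts)

* `discChart hi hdim`: a disc as a chart `M ⊇ i(E) → E` (inverse of the open embedding `i`),
  smooth with smooth inverse for any target model.
* `D.Φ`: Kervaire–Milnor's identification `e₁ ≫ ψ ≫ e₂⁻¹` between the punctured discs, `ψ` the
  disc inversion of `ConnectedSumData.lean`; `D.connectedSumRel_iff` (its graph is
  `connectedSumRel i j`), `D.isClosed_connectedSumRel`.
* `D.A = M ∖ {i 0}`, `D.BY = Y ∖ {j 0}` (open submanifolds) and `D.B`, the second piece recharted on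
  the half-space through `Literature.Geometry.Manifold.Rechart` and `HalfSpaceCharted`
  (`D.toB : D.BY → D.B` is a `C^∞` embedding `IY → 𝓡∂ (m + 1)` with `C^∞` inverse `D.ofB`,
  `HalfSpaceCharted.isSmoothEmbedding_of_into`).
* `D.φ : D.A ⇀ D.B`, the gluing map, `C^∞` with `C^∞` inverse; `D.glueData`; **`D.P`, the connected
  sum `M # Y`** as a glued `C^∞` manifold with boundary, Hausdorff (`t2Space_P`: the graph of the
  gluing map is closed), compact for compact `M`, `Y` (`compactSpace_P`), second countable.
* `D.isOpenGluingWith`, **`D.isConnectedSum : IsConnectedSum (𝓡∂ (m + 1)) (𝓡∂ (m + 1)) IY M Y D.P`**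
  with the explicit gluing embeddings `inl : M ∖ {i 0} → P`, `D.inrY : Y ∖ {j 0} → P`.
* `D.boundary_P_eq` (**`∂(M # Y) = ∂M`**) and `D.boundaryData b : BoundaryData (𝓡∂ (m + 1)) D.P (𝓡 m)`,
  the boundary datum of `M # Y` with the carrier of the boundary datum `b` of `M` and inclusion
  `inl ∘ incl`.

## Design notes

* Only same-model transports and the explicit recharts of `HalfSpaceChartedEmbedding.lean` are
  used: transporting smooth embeddings across unrelated models is false in Mathlib's formalism
  (`ConnectedSumTransportProofs.lean`, `OpenGluingCounterexample.lean`).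
* The disc of `Y` is `ℝᵐ⁺¹ → Y` (the model vector space of the SUM, as `IsConnectedSum` requires),
  not `EY → Y`; the dimension hypothesis of `discChart` is `L`.
* `M : Type u`, `Y : Type v`, `D.P : Type (max u v)`; the boundary datum is given for `M`, `Y` in a
  common universe (the carrier of a boundary datum lives in the universe of the manifold).

## References

* M. Kervaire, J. Milnor, *Groups of homotopy spheres I*, Ann. of Math. 77 (1963), §2.
  [KervaireMilnorAnnals1963]
* A. Kosinski, *Differential Manifolds*, Academic Press (1993), Ch. VI §1, Thm. (1.1). [Kosinski1993]
-/

open scoped Manifold ContDiff Topology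
open Set Function Metric OpenPartialHomeomorph Topology

noncomputable section

namespace Literature.Topology.FourManifolds

universe u v

/-- Local notation: `𝔼 n` is the model Euclidean space `EuclideanSpace ℝ (Fin n)`. -/
local notation "𝔼 " n:arg => EuclideanSpace ℝ (Fin n)
/-- Local notation: `ℍ n` is the model half-space `EuclideanHalfSpace n`. -/
local notation "ℍ " n:arg => EuclideanHalfSpace n

/-! ### A disc as a chart onto the model vector space -/

section DiscChart

variable {E : Type*} [NormedAddCommGroup E] [NormedSpace ℝ E] [FiniteDimensional ℝ E]
  {E' H : Type*} [NormedAddCommGroup E'] [NormedSpace ℝ E'] [FiniteDimensional ℝ E']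
  [TopologicalSpace H] {I : ModelWithCorners ℝ E' H}
  {M : Type*} [TopologicalSpace M] [ChartedSpace H M] {i : E → M}

/-- A disc `i : E → M` (a smooth embedding of a vector space of the dimension of `M`) is an open
embedding (invariance of domain for equidimensional immersions,
`Manifold.IsSmoothEmbedding.isOpenMap_of_finrank_eq`). [folklore] -/
theorem isOpenEmbedding_disc' (hi : Manifold.IsSmoothEmbedding 𝓘(ℝ, E) I ∞ i)
    (hdim : Module.finrank ℝ E = Module.finrank ℝ E') : IsOpenEmbedding i :=
  .of_continuous_injective_isOpenMap hi.contMDiff.continuous hi.isEmbedding.injective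
    (Manifold.IsSmoothEmbedding.isOpenMap_of_finrank_eq hi hdim)

/-- **A disc as a chart.** The inverse of a disc `i : E → M` (a smooth embedding of a vector space
of the dimension of `M`, an open embedding by `isOpenEmbedding_disc'`) as an open partial
homeomorphism `M ⊇ i(E) → E` onto the whole of `E` (Kosinski, *Differential Manifolds* (1993),
VI.1: the "imbeddings `hᵢ : Rᵐ → Mᵢ`" of a connected sum are used through their inverses). [folklore] -/
def discChart (hi : Manifold.IsSmoothEmbedding 𝓘(ℝ, E) I ∞ i)
    (hdim : Module.finrank ℝ E = Module.finrank ℝ E') : OpenPartialHomeomorph M E :=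
  ((isOpenEmbedding_disc' hi hdim).toOpenPartialHomeomorph i).symm

variable (hi : Manifold.IsSmoothEmbedding 𝓘(ℝ, E) I ∞ i)
  (hdim : Module.finrank ℝ E = Module.finrank ℝ E')

/-- The source of the disc chart is the range of the disc. [folklore] -/
@[simp] theorem discChart_source : (discChart hi hdim).source = range i := by
  rw [discChart, symm_source, IsOpenEmbedding.toOpenPartialHomeomorph_target]

/-- The target of the disc chart is all of `E`. [folklore] -/
@[simp] theorem discChart_target : (discChart hi hdim).target = univ := by
  rw [discChart, symm_target, IsOpenEmbedding.toOpenPartialHomeomorph_source]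

/-- The inverse of the disc chart is the disc. [folklore] -/
@[simp] theorem discChart_symm_apply (v : E) : (discChart hi hdim).symm v = i v := by
  rw [discChart, symm_symm, IsOpenEmbedding.toOpenPartialHomeomorph_apply]

/-- The inverse of the disc chart is the disc (as functions). [folklore] -/
theorem coe_discChart_symm : ((discChart hi hdim).symm : E → M) = i :=
  funext (discChart_symm_apply hi hdim)

/-- `discChart ∘ i = id`. [folklore] -/
@[simp] theorem discChart_disc (v : E) : discChart hi hdim (i v) = v :=
  (isOpenEmbedding_disc' hi hdim).toOpenPartialHomeomorph_left_inv

/-- `i ∘ discChart = id` on the range of the disc. [folklore] -/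
theorem disc_discChart {p : M} (hp : p ∈ range i) : i (discChart hi hdim p) = p := by
  obtain ⟨v, rfl⟩ := hp
  rw [discChart_disc]

/-- Points of the disc lie in the source of the disc chart. [folklore] -/
theorem disc_mem_discChart_source (v : E) : i v ∈ (discChart hi hdim).source := by
  rw [discChart_source]; exact mem_range_self v

/-- **The disc chart is smooth** on its source, for an arbitrary model `I` on `M`
(`contMDiffOn_symm_of_isSmoothEmbedding`). [folklore] -/
theorem contMDiffOn_discChart : ContMDiffOn I 𝓘(ℝ, E) ∞ (discChart hi hdim) (discChart hi hdim).source := by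
  rw [discChart_source]
  exact contMDiffOn_symm_of_isSmoothEmbedding hi (isOpenEmbedding_disc' hi hdim)

/-- The inverse of the disc chart is smooth (it is the disc). [folklore] -/
theorem contMDiff_discChart_symm : ContMDiff 𝓘(ℝ, E) I ∞ (discChart hi hdim).symm := by
  rw [coe_discChart_symm]; exact hi.contMDiff

/-- A point of the disc with nonzero coordinate is not the centre. [folklore] -/
theorem ne_center_of_discChart_ne_zero {p : M} (hp : p ∈ range i) (h0 : discChart hi hdim p ≠ 0) :
    p ≠ i 0 := by
  rintro rfl
  exact h0 (discChart_disc hi hdim 0)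

end DiscChart

/-! ### The data of an interior connected sum -/

section Data

variable (m : ℕ) (M : Type u) [TopologicalSpace M] [ChartedSpace (ℍ (m + 1)) M]
  {EY HY : Type*} [NormedAddCommGroup EY] [NormedSpace ℝ EY] [TopologicalSpace HY]
  (IY : ModelWithCorners ℝ EY HY) (Y : Type v) [TopologicalSpace Y] [ChartedSpace HY Y]

/-- **Interior connected sum data.** The data from which the connected sum `M # Y` of an
`(m+1)`-manifold with boundary `M` (charted on the half-space `ℍᵐ⁺¹`) and a boundaryless
`(m+1)`-manifold `Y` (charted on any model `IY` whose model vector space is identified with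
`ℝᵐ⁺¹` by `L`) is built: discs `i : ℝᵐ⁺¹ → M`, `j : ℝᵐ⁺¹ → Y` (smooth embeddings of the model
vector space; `i` automatically lands in the interior of `M`, `isInteriorPoint_of_isSmoothEmbedding_disc`)
(Kervaire–Milnor, *Groups of homotopy spheres I* (1963), §2; Kosinski, *Differential Manifolds*
(1993), VI.1, discs "in `Int M`"). [cite: KervaireMilnorAnnals1963, §2] -/
structure InteriorSumData where
  /-- the disc of the manifold with boundary `M` -/
  i : 𝔼 (m + 1) → M
  /-- the disc of the boundaryless manifold `Y` -/
  j : 𝔼 (m + 1) → Y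
  /-- `i` is a smooth embedding of `ℝᵐ⁺¹` -/
  isSmoothEmbedding_i : Manifold.IsSmoothEmbedding 𝓘(ℝ, 𝔼 (m + 1)) (𝓡∂ (m + 1)) ∞ i
  /-- `j` is a smooth embedding of `ℝᵐ⁺¹` -/
  isSmoothEmbedding_j : Manifold.IsSmoothEmbedding 𝓘(ℝ, 𝔼 (m + 1)) IY ∞ j
  /-- identification of the model vector space of `Y` with `ℝᵐ⁺¹` -/
  L : EY ≃L[ℝ] 𝔼 (m + 1)

end Data

namespace InteriorSumData

variable {m : ℕ} {M : Type u} [TopologicalSpace M] [ChartedSpace (ℍ (m + 1)) M]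
  {EY HY : Type*} [NormedAddCommGroup EY] [NormedSpace ℝ EY] [TopologicalSpace HY]
  {IY : ModelWithCorners ℝ EY HY} {Y : Type v} [TopologicalSpace Y] [ChartedSpace HY Y]
  (D : InteriorSumData m M IY Y)

/-! ### The disc charts and Kervaire–Milnor's identification -/

/-- The first disc is continuous. [folklore] -/
theorem continuous_i : Continuous D.i := D.isSmoothEmbedding_i.contMDiff.continuous

/-- The second disc is continuous. [folklore] -/
theorem continuous_j : Continuous D.j := D.isSmoothEmbedding_j.contMDiff.continuous

/-- The first disc is injective. [folklore] -/
theorem injective_i : Injective D.i := D.isSmoothEmbedding_i.isEmbedding.injective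

/-- The second disc is injective. [folklore] -/
theorem injective_j : Injective D.j := D.isSmoothEmbedding_j.isEmbedding.injective

/-- The model vector space of `Y` has dimension `m + 1`. [folklore] -/
theorem finrank_eq (D : InteriorSumData m M IY Y) :
    Module.finrank ℝ (𝔼 (m + 1)) = Module.finrank ℝ EY :=
  D.L.toLinearEquiv.finrank_eq.symm

/-- The chart `M ⊇ i(ℝᵐ⁺¹) → ℝᵐ⁺¹` inverse to the first disc. [folklore] -/
def e₁ : OpenPartialHomeomorph M (𝔼 (m + 1)) := discChart D.isSmoothEmbedding_i rfl

/-- The source of `e₁` is the range of `i`. [folklore] -/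
@[simp] theorem e₁_source : D.e₁.source = range D.i := discChart_source _ _

/-- The target of `e₁` is `ℝᵐ⁺¹`. [folklore] -/
@[simp] theorem e₁_target : D.e₁.target = univ := discChart_target _ _

/-- `e₁ (i v) = v`. [folklore] -/
@[simp] theorem e₁_i (v : 𝔼 (m + 1)) : D.e₁ (D.i v) = v := discChart_disc _ _ v

/-- `e₁.symm = i`. [folklore] -/
@[simp] theorem e₁_symm_apply (v : 𝔼 (m + 1)) : D.e₁.symm v = D.i v := discChart_symm_apply _ _ v

/-- `i (e₁ p) = p` on the range of `i`. [folklore] -/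
theorem i_e₁ {p : M} (hp : p ∈ range D.i) : D.i (D.e₁ p) = p := disc_discChart _ _ hp

variable [FiniteDimensional ℝ EY]

/-- The chart `Y ⊇ j(ℝᵐ⁺¹) → ℝᵐ⁺¹` inverse to the second disc. [folklore] -/
def e₂ : OpenPartialHomeomorph Y (𝔼 (m + 1)) := discChart D.isSmoothEmbedding_j D.finrank_eq

/-- The source of `e₂` is the range of `j`. [folklore] -/
@[simp] theorem e₂_source : D.e₂.source = range D.j := discChart_source _ _

/-- The target of `e₂` is `ℝᵐ⁺¹`. [folklore] -/
@[simp] theorem e₂_target : D.e₂.target = univ := discChart_target _ _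

/-- `e₂ (j v) = v`. [folklore] -/
@[simp] theorem e₂_j (v : 𝔼 (m + 1)) : D.e₂ (D.j v) = v := discChart_disc _ _ v

/-- `e₂.symm = j`. [folklore] -/
@[simp] theorem e₂_symm_apply (v : 𝔼 (m + 1)) : D.e₂.symm v = D.j v := discChart_symm_apply _ _ v

/-- `j (e₂ q) = q` on the range of `j`. [folklore] -/
theorem j_e₂ {q : Y} (hq : q ∈ range D.j) : D.j (D.e₂ q) = q := disc_discChart _ _ hq

/-- **Kervaire–Milnor's identification** `Φ = e₁ ≫ ψ ≫ e₂⁻¹` between the punctured discs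
`i (B ∖ 0) ⊆ M` and `j (B ∖ 0) ⊆ Y`, `ψ` the inversion `t • u ↦ (1 - t) • u` of the punctured
unit ball (`discInversion`). [cite: KervaireMilnorAnnals1963, §2] -/
def Φ : OpenPartialHomeomorph M Y := D.e₁ ≫ₕ (discInversion ≫ₕ D.e₂.symm)

/-- `Φ = j ∘ ψ ∘ e₁`. [cite: KervaireMilnorAnnals1963, §2] -/
theorem Φ_apply (p : M) : D.Φ p = D.j (discInversionFun (D.e₁ p)) := by
  simp [Φ]

/-- `Φ.symm = i ∘ ψ ∘ e₂`. [cite: KervaireMilnorAnnals1963, §2] -/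
theorem Φ_symm_apply (q : Y) : D.Φ.symm q = D.i (discInversionFun (D.e₂ q)) := by
  simp [Φ]

/-- The source of `Φ` is the punctured open disc `i (B ∖ 0)`. [cite: KervaireMilnorAnnals1963, §2] -/
theorem mem_Φ_source {p : M} :
    p ∈ D.Φ.source ↔ p ∈ range D.i ∧ 0 < ‖D.e₁ p‖ ∧ ‖D.e₁ p‖ < 1 := by
  simp only [Φ, trans_source, symm_source, e₂_target, preimage_univ, inter_univ, mem_inter_iff,
    mem_preimage, mem_discInversion_source, e₁_source]

/-- The target of `Φ` is the punctured open disc `j (B ∖ 0)`. [cite: KervaireMilnorAnnals1963, §2] -/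
theorem mem_Φ_target {q : Y} :
    q ∈ D.Φ.target ↔ q ∈ range D.j ∧ 0 < ‖D.e₂ q‖ ∧ ‖D.e₂ q‖ < 1 := by
  simp only [Φ, trans_target, symm_target, e₁_target, preimage_univ, inter_univ, mem_inter_iff,
    mem_preimage, discInversion_target, mem_discInversion_source, symm_symm, e₂_source]

/-- **`Φ` is smooth** on its source (models `𝓡∂ (m + 1)` and `IY`). [cite: KervaireMilnorAnnals1963, §2] -/
theorem contMDiffOn_Φ : ContMDiffOn (𝓡∂ (m + 1)) IY ∞ D.Φ D.Φ.source := by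
  have h₁ : ContMDiffOn (𝓡∂ (m + 1)) 𝓘(ℝ, 𝔼 (m + 1)) ∞ D.e₁ D.e₁.source := contMDiffOn_discChart _ _
  have h₂ : ContMDiffOn 𝓘(ℝ, 𝔼 (m + 1)) 𝓘(ℝ, 𝔼 (m + 1)) ∞
      (discInversion : 𝔼 (m + 1) → 𝔼 (m + 1)) discInversion.source := contMDiffOn_discInversion
  have h₃ : ContMDiff 𝓘(ℝ, 𝔼 (m + 1)) IY ∞ D.e₂.symm := contMDiff_discChart_symm _ _
  have h : ContMDiffOn (𝓡∂ (m + 1)) IY ∞ (D.e₂.symm ∘ discInversion ∘ D.e₁) D.Φ.source := by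
    refine h₃.comp_contMDiffOn (h₂.comp (h₁.mono fun p hp => hp.1) fun p hp => hp.2.1)
  exact h.congr fun p _ => rfl

/-- **`Φ.symm` is smooth** on the target (models `IY` and `𝓡∂ (m + 1)`). [cite: KervaireMilnorAnnals1963, §2] -/
theorem contMDiffOn_Φ_symm : ContMDiffOn IY (𝓡∂ (m + 1)) ∞ D.Φ.symm D.Φ.target := by
  have h₁ : ContMDiffOn IY 𝓘(ℝ, 𝔼 (m + 1)) ∞ D.e₂ D.e₂.source := contMDiffOn_discChart _ _
  have h₂ : ContMDiffOn 𝓘(ℝ, 𝔼 (m + 1)) 𝓘(ℝ, 𝔼 (m + 1)) ∞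
      (discInversion : 𝔼 (m + 1) → 𝔼 (m + 1)) discInversion.source := contMDiffOn_discInversion
  have h₃ : ContMDiff 𝓘(ℝ, 𝔼 (m + 1)) (𝓡∂ (m + 1)) ∞ D.e₁.symm := contMDiff_discChart_symm _ _
  have hsub : D.Φ.target ⊆ D.e₂.source ∩ D.e₂ ⁻¹' discInversion.source := fun q hq => by
    rw [mem_Φ_target] at hq
    exact ⟨by rw [e₂_source]; exact hq.1, hq.2⟩
  have h : ContMDiffOn IY (𝓡∂ (m + 1)) ∞ (D.e₁.symm ∘ discInversion ∘ D.e₂)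
      (D.e₂.source ∩ D.e₂ ⁻¹' discInversion.source) :=
    h₃.comp_contMDiffOn (h₂.comp (h₁.mono inter_subset_left) fun q hq => hq.2)
  exact (h.mono hsub).congr fun q _ => by rw [Φ_symm_apply]; simp

/-! ### The punctured pieces and the connected sum relation -/

variable [T2Space M] [T2Space Y]

/-- The first punctured piece `M ∖ {i 0}` (an open submanifold with boundary). [cite: KervaireMilnorAnnals1963, §2] -/
abbrev A : TopologicalSpace.Opens M := puncture D.i

/-- The second punctured piece `Y ∖ {j 0}`, with the charts of `Y`. [cite: KervaireMilnorAnnals1963, §2] -/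
abbrev BY : TopologicalSpace.Opens Y := puncture D.j

omit [T2Space Y] in
/-- The source of `Φ` misses the centre `i 0`. [cite: KervaireMilnorAnnals1963, §2] -/
theorem Φ_source_subset : D.Φ.source ⊆ D.A := fun p hp => by
  rw [mem_Φ_source] at hp
  exact ne_center_of_discChart_ne_zero _ _ hp.1 (norm_pos_iff.1 hp.2.1)

omit [T2Space M] in
/-- The target of `Φ` misses the centre `j 0`. [cite: KervaireMilnorAnnals1963, §2] -/
theorem Φ_target_subset : D.Φ.target ⊆ D.BY := fun q hq => by
  rw [mem_Φ_target] at hq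
  exact ne_center_of_discChart_ne_zero _ _ hq.1 (norm_pos_iff.1 hq.2.1)

/-- **The connected sum relation is the graph of `Φ`**: for `a ∈ M ∖ {i 0}`, `b ∈ Y ∖ {j 0}`,
`connectedSumRel i j a b ↔ a ∈ Φ.source ∧ Φ a = b`. [cite: KervaireMilnorAnnals1963, §2] -/
theorem connectedSumRel_iff (a : D.A) (b : D.BY) :
    connectedSumRel D.i D.j a b ↔ (a : M) ∈ D.Φ.source ∧ D.Φ a = b := by
  constructor
  · rintro ⟨u, t, hu, ht, ha, hb⟩
    have hv : ‖t • u‖ = t := by rw [norm_smul, Real.norm_eq_abs, abs_of_pos ht.1, hu, mul_one]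
    have ha' : (a : M) ∈ range D.i := ha ▸ mem_range_self _
    have hea : D.e₁ a = t • u := by rw [ha, D.e₁_i]
    refine ⟨D.mem_Φ_source.2 ⟨ha', ?_, ?_⟩, ?_⟩
    · rw [hea, hv]; exact ht.1
    · rw [hea, hv]; exact ht.2
    · rw [Φ_apply, hea, discInversionFun_smul hu ht.1, hb]
  · rintro ⟨hs, hΦ⟩
    obtain ⟨ha', h0, h1⟩ := D.mem_Φ_source.1 hs
    set v := D.e₁ a with hv
    have hn0 : ‖v‖ ≠ 0 := h0.ne'
    have hu : ‖‖v‖⁻¹ • v‖ = 1 := by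
      rw [norm_smul, norm_inv, norm_norm, inv_mul_cancel₀ hn0]
    have hvu : ‖v‖ • ‖v‖⁻¹ • v = v := by rw [smul_smul, mul_inv_cancel₀ hn0, one_smul]
    refine ⟨‖v‖⁻¹ • v, ‖v‖, hu, ⟨h0, h1⟩, ?_, ?_⟩
    · rw [hvu, hv, D.i_e₁ ha']
    · rw [← hΦ, Φ_apply, ← discInversionFun_smul hu h0, hvu]

omit [FiniteDimensional ℝ EY] in
/-- **The graph of the connected sum relation is closed** in `(M ∖ {i 0}) × (Y ∖ {j 0})` (trace of
the compact set `{(i (t • u), j ((1 - t) • u)) | ‖u‖ = 1, 0 ≤ t ≤ 1}`).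
[cite: KervaireMilnorAnnals1963, §2] [cite: Kosinski1993, Ch. VI §1, (1.1)] -/
theorem isClosed_connectedSumRel :
    IsClosed {p : D.A × D.BY | connectedSumRel D.i D.j p.1 p.2} := by
  set g : (𝔼 (m + 1)) × ℝ → M × Y := fun q => (D.i (q.2 • q.1), D.j ((1 - q.2) • q.1)) with hg
  have hgc : Continuous g :=
    (D.continuous_i.comp (continuous_snd.smul continuous_fst)).prodMk
      (D.continuous_j.comp ((continuous_const.sub continuous_snd).smul continuous_fst))
  set K := g '' (sphere (0 : 𝔼 (m + 1)) 1 ×ˢ Icc (0 : ℝ) 1) with hK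
  have hKc : IsCompact K := ((isCompact_sphere 0 1).prod isCompact_Icc).image hgc
  have heq : {p : D.A × D.BY | connectedSumRel D.i D.j p.1 p.2} =
      (fun p : D.A × D.BY => ((p.1 : M), (p.2 : Y))) ⁻¹' K := by
    ext ⟨a, b⟩
    simp only [mem_setOf_eq, mem_preimage, hK, mem_image, mem_prod, mem_sphere_zero_iff_norm,
      mem_Icc, hg, Prod.mk.injEq, Prod.exists]
    constructor
    · rintro ⟨u, t, hu, ht, ha, hb⟩
      exact ⟨u, t, ⟨hu, ht.1.le, ht.2.le⟩, ha.symm, hb.symm⟩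
    · rintro ⟨u, t, ⟨hu, h0, h1⟩, ha, hb⟩
      have ht0 : t ≠ 0 := by
        rintro rfl
        exact a.2 (by rw [mem_singleton_iff, ← ha, zero_smul])
      have ht1 : t ≠ 1 := by
        rintro rfl
        exact b.2 (by rw [mem_singleton_iff, ← hb, sub_self, zero_smul])
      exact ⟨u, t, hu, ⟨lt_of_le_of_ne h0 (Ne.symm ht0), lt_of_le_of_ne h1 ht1⟩, ha.symm, hb.symm⟩
  rw [heq]
  exact hKc.isClosed.preimage (by fun_prop)

omit [T2Space Y] [FiniteDimensional ℝ EY] in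
/-- The first punctured piece is nonempty (it contains `i e₀`). [folklore] -/
theorem nonempty_A : Nonempty D.A := by
  refine ⟨⟨D.i (EuclideanSpace.single 0 1), fun h => ?_⟩⟩
  have h' := D.injective_i (mem_singleton_iff.1 h)
  simpa using congrArg (fun v : 𝔼 (m + 1) => v 0) h'

omit [T2Space M] [FiniteDimensional ℝ EY] in
/-- The second punctured piece is nonempty (it contains `j e₀`). [folklore] -/
theorem nonempty_BY : Nonempty D.BY := by
  refine ⟨⟨D.j (EuclideanSpace.single 0 1), fun h => ?_⟩⟩
  have h' := D.injective_j (mem_singleton_iff.1 h)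
  simpa using congrArg (fun v : 𝔼 (m + 1) => v 0) h'


/-! ### The gluing map between the punctured pieces (charts of `Y` on the second piece) -/

/-- The gluing map `Φ` as an open partial homeomorphism between the punctured pieces
`M ∖ {i 0}` and `Y ∖ {j 0}`. [cite: KervaireMilnorAnnals1963, §2] -/
def φY : OpenPartialHomeomorph D.A D.BY :=
  D.Φ.subtypeRestr D.nonempty_A ≫ₕ (D.BY.openPartialHomeomorphSubtypeCoe D.nonempty_BY).symm

/-- The source of `φY` is that of `Φ`. [folklore] -/
theorem mem_φY_source {a : D.A} : a ∈ D.φY.source ↔ (a : M) ∈ D.Φ.source := by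
  simp only [φY, trans_source, subtypeRestr_source, mem_preimage, symm_source,
    TopologicalSpace.Opens.openPartialHomeomorphSubtypeCoe_target, mem_inter_iff, subtypeRestr_coe,
    restrict_apply, SetLike.mem_coe, and_iff_left_iff_imp]
  exact fun h => D.Φ_target_subset (D.Φ.map_source h)

/-- `φY` is `Φ` on the punctured piece. [folklore] -/
theorem coe_φY {a : D.A} (ha : a ∈ D.φY.source) : ((D.φY a : D.BY) : Y) = D.Φ a := by
  have h : D.Φ a ∈ (D.BY.openPartialHomeomorphSubtypeCoe D.nonempty_BY).target := by
    rw [TopologicalSpace.Opens.openPartialHomeomorphSubtypeCoe_target]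
    exact D.Φ_target_subset (D.Φ.map_source (D.mem_φY_source.1 ha))
  exact (D.BY.openPartialHomeomorphSubtypeCoe D.nonempty_BY).right_inv h

/-- The target of `φY` is that of `Φ`. [folklore] -/
theorem mem_φY_target {b : D.BY} : b ∈ D.φY.target ↔ (b : Y) ∈ D.Φ.target := by
  simp only [φY, trans_target, symm_target, TopologicalSpace.Opens.openPartialHomeomorphSubtypeCoe_source,
    symm_symm, TopologicalSpace.Opens.openPartialHomeomorphSubtypeCoe_coe, univ_inter, mem_preimage,
    subtypeRestr_def, TopologicalSpace.Opens.openPartialHomeomorphSubtypeCoe_target, mem_inter_iff,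
    SetLike.mem_coe, and_iff_left_iff_imp]
  exact fun h => D.Φ_source_subset (D.Φ.map_target h)

/-- `φY.symm` is `Φ.symm` on the punctured piece. [folklore] -/
theorem coe_φY_symm {b : D.BY} (hb : b ∈ D.φY.target) :
    ((D.φY.symm b : D.A) : M) = D.Φ.symm b := by
  have hb' : (b : Y) ∈ (D.Φ.subtypeRestr D.nonempty_A).target := by
    have := hb
    simp only [φY, trans_target, mem_inter_iff, mem_preimage] at this
    exact this.2
  exact D.Φ.subtypeRestr_symm_apply D.nonempty_A hb'

/-- The connected sum relation is the gluing relation of `φY`. [cite: KervaireMilnorAnnals1963, §2] -/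
theorem connectedSumRel_iff_φY (a : D.A) (b : D.BY) :
    connectedSumRel D.i D.j a b ↔ a ∈ D.φY.source ∧ D.φY a = b := by
  rw [D.connectedSumRel_iff, D.mem_φY_source]
  refine and_congr_right fun ha => ?_
  rw [Subtype.ext_iff, D.coe_φY (D.mem_φY_source.2 ha)]

/-- `φY` is smooth (models `𝓡∂ (m + 1)`, `IY`). [cite: KervaireMilnorAnnals1963, §2] -/
theorem contMDiffOn_φY : ContMDiffOn (𝓡∂ (m + 1)) IY ∞ D.φY D.φY.source := by
  intro a ha
  rw [← ContMDiffWithinAt.subtypeVal_comp_iff]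
  have h : ContMDiffOn (𝓡∂ (m + 1)) IY ∞ (D.Φ ∘ (Subtype.val : D.A → M)) D.φY.source :=
    D.contMDiffOn_Φ.comp contMDiff_subtype_val.contMDiffOn fun a ha => D.mem_φY_source.1 ha
  exact (h a ha).congr (fun a' ha' => D.coe_φY ha') (D.coe_φY ha)

/-- `φY.symm` is smooth (models `IY`, `𝓡∂ (m + 1)`). [cite: KervaireMilnorAnnals1963, §2] -/
theorem contMDiffOn_φY_symm : ContMDiffOn IY (𝓡∂ (m + 1)) ∞ D.φY.symm D.φY.target := by
  intro b hb
  rw [← ContMDiffWithinAt.subtypeVal_comp_iff]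
  have h : ContMDiffOn IY (𝓡∂ (m + 1)) ∞ (D.Φ.symm ∘ (Subtype.val : D.BY → Y)) D.φY.target :=
    D.contMDiffOn_Φ_symm.comp contMDiff_subtype_val.contMDiffOn fun b hb => D.mem_φY_target.1 hb
  exact (h b hb).congr (fun b' hb' => D.coe_φY_symm hb') (D.coe_φY_symm hb)

/-! ### The second piece, recharted on the half-space -/

section Rechart

variable [IY.Boundaryless]

/-- The change of model `HY ≃ₜ ℝᵐ⁺¹`, `x ↦ L (IY x)` (`IY` is a homeomorphism onto `EY`, being
boundaryless). [folklore] -/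
def modelHomeo : HY ≃ₜ 𝔼 (m + 1) := IY.toHomeomorph.trans D.L.toHomeomorph

omit [FiniteDimensional ℝ EY] [T2Space M] [T2Space Y] in
/-- `modelHomeo x = L (IY x)`. [folklore] -/
theorem modelHomeo_apply (x : HY) : D.modelHomeo x = D.L (IY x) := rfl

/-- The second punctured piece recharted on `ℝᵐ⁺¹` (`Literature.Geometry.Manifold.Rechart`). [folklore] -/
abbrev BE : Type v := Literature.Geometry.Manifold.Rechart D.modelHomeo ↥D.BY

variable [IsManifold IY ∞ Y]

/-- The recharted second piece is a `C^∞` manifold modelled on `ℝᵐ⁺¹`. [folklore] -/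
instance isManifold_BE : IsManifold (𝓡 (m + 1)) ∞ D.BE :=
  Literature.Geometry.Manifold.Rechart.isManifold (n := ∞) _ _
    (Literature.Geometry.Manifold.Rechart.contMDiff_of_apply_eq_linear _ D.L D.modelHomeo_apply)
    (Literature.Geometry.Manifold.Rechart.contMDiff_symm_of_apply_eq_linear _ D.L D.modelHomeo_apply)

/-- **The second piece** `B = Y ∖ {j 0}`, recharted on the closed half-space `ℍᵐ⁺¹` (tree synonym
`HalfSpaceCharted`; a manifold with boundary whose boundary is empty), ready to be glued to
`M ∖ {i 0}` by the tree's gluing of half-space charted pieces. [folklore] -/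
abbrev B : Type v := HalfSpaceCharted D.BE

/-- The identity `Y ∖ {j 0} → B`. [folklore] -/
def toB : D.BY → D.B :=
  HalfSpaceCharted.of ∘ Literature.Geometry.Manifold.Rechart.into D.modelHomeo ↥D.BY

/-- The identity `B → Y ∖ {j 0}`. [folklore] -/
def ofB : D.B → D.BY :=
  Literature.Geometry.Manifold.Rechart.out D.modelHomeo ↥D.BY ∘ HalfSpaceCharted.of.symm

omit [FiniteDimensional ℝ EY] [T2Space M] [IsManifold IY ∞ Y] in
/-- `ofB ∘ toB = id` (definitional). [folklore] -/
@[simp] theorem ofB_toB (b : D.BY) : D.ofB (D.toB b) = b := rfl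

omit [FiniteDimensional ℝ EY] [T2Space M] [IsManifold IY ∞ Y] in
/-- `toB ∘ ofB = id` (definitional). [folklore] -/
@[simp] theorem toB_ofB (c : D.B) : D.toB (D.ofB c) = c := rfl

omit [FiniteDimensional ℝ EY] [T2Space M] [IsManifold IY ∞ Y] in
/-- `toB` is injective. [folklore] -/
theorem injective_toB : Injective D.toB := fun b b' h => by
  simpa using congrArg D.ofB h

omit [FiniteDimensional ℝ EY] [T2Space M] [IsManifold IY ∞ Y] in
/-- `toB` is surjective. [folklore] -/
theorem surjective_toB : Surjective D.toB := fun c => ⟨D.ofB c, rfl⟩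

omit [FiniteDimensional ℝ EY] [T2Space M] in
/-- **`toB` is a `C^∞` embedding** (models `IY` and `𝓡∂ (m + 1)`;
`HalfSpaceCharted.isSmoothEmbedding_of_into`). [folklore] -/
theorem isSmoothEmbedding_toB : Manifold.IsSmoothEmbedding IY (𝓡∂ (m + 1)) ∞ D.toB :=
  HalfSpaceCharted.isSmoothEmbedding_of_into D.modelHomeo D.L D.modelHomeo_apply

omit [FiniteDimensional ℝ EY] [T2Space M] in
/-- `toB` is smooth. [folklore] -/
theorem contMDiff_toB : ContMDiff IY (𝓡∂ (m + 1)) ∞ D.toB := D.isSmoothEmbedding_toB.contMDiff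

omit [FiniteDimensional ℝ EY] [T2Space M] in
/-- `ofB` is smooth. [folklore] -/
theorem contMDiff_ofB : ContMDiff (𝓡∂ (m + 1)) IY ∞ D.ofB :=
  HalfSpaceCharted.contMDiff_out_of_symm D.modelHomeo D.L D.modelHomeo_apply

/-- The identity `Y ∖ {j 0} ≃ₜ B` as a homeomorphism. [folklore] -/
def toBHomeomorph : D.BY ≃ₜ D.B where
  toFun := D.toB
  invFun := D.ofB
  left_inv := D.ofB_toB
  right_inv := D.toB_ofB
  continuous_toFun := D.contMDiff_toB.continuous
  continuous_invFun := D.contMDiff_ofB.continuous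

omit [FiniteDimensional ℝ EY] [T2Space M] in
/-- `toBHomeomorph` is `toB` as a function (definitional). [folklore] -/
@[simp] theorem coe_toBHomeomorph : ⇑D.toBHomeomorph = D.toB := rfl

omit [FiniteDimensional ℝ EY] [T2Space M] in
/-- `toBHomeomorph.symm` is `ofB` as a function (definitional). [folklore] -/
@[simp] theorem coe_toBHomeomorph_symm : ⇑D.toBHomeomorph.symm = D.ofB := rfl

omit [FiniteDimensional ℝ EY] [T2Space M] [IsManifold IY ∞ Y] in
/-- The second piece has no boundary points. [folklore] -/
theorem not_isBoundaryPoint_B (c : D.B) : ¬ (𝓡∂ (m + 1)).IsBoundaryPoint c := by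
  intro h
  have : c ∈ (𝓡∂ (m + 1)).boundary D.B := h
  rw [HalfSpaceCharted.boundary_eq_empty] at this
  exact this

/-! ### The gluing datum and the glued manifold -/

/-- **The gluing map** `M ∖ {i 0} ⊇ i (B ∖ 0) ≅ j (B ∖ 0) ⊆ B` of the connected sum: `Φ` between
the punctured pieces, followed by the identity onto the recharted second piece. [cite: KervaireMilnorAnnals1963, §2] -/
def φ : OpenPartialHomeomorph D.A D.B := D.φY ≫ₕ D.toBHomeomorph.toOpenPartialHomeomorph

/-- The source of `φ` is that of `φY`. [folklore] -/
@[simp] theorem φ_source : D.φ.source = D.φY.source := by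
  simp [φ]

/-- `φ = toB ∘ φY`. [folklore] -/
theorem φ_apply (a : D.A) : D.φ a = D.toB (D.φY a) := rfl

/-- `φ.symm = φY.symm ∘ ofB`. [folklore] -/
theorem φ_symm_apply (c : D.B) : D.φ.symm c = D.φY.symm (D.ofB c) := rfl

/-- The target of `φ`. [folklore] -/
theorem mem_φ_target {c : D.B} : c ∈ D.φ.target ↔ D.ofB c ∈ D.φY.target := by
  simp [φ]

/-- The connected sum relation is the gluing relation of `φ` (through `toB`). [cite: KervaireMilnorAnnals1963, §2] -/
theorem connectedSumRel_iff_φ (a : D.A) (b : D.BY) :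
    connectedSumRel D.i D.j a b ↔ a ∈ D.φ.source ∧ D.φ a = D.toB b := by
  rw [D.connectedSumRel_iff_φY, φ_source, φ_apply, D.injective_toB.eq_iff]

/-- `φ` is smooth (model `𝓡∂ (m + 1)` on both pieces). [folklore] -/
theorem contMDiffOn_φ : ContMDiffOn (𝓡∂ (m + 1)) (𝓡∂ (m + 1)) ∞ D.φ D.φ.source := by
  rw [φ_source]
  exact D.contMDiff_toB.comp_contMDiffOn D.contMDiffOn_φY

/-- `φ.symm` is smooth. [folklore] -/
theorem contMDiffOn_φ_symm : ContMDiffOn (𝓡∂ (m + 1)) (𝓡∂ (m + 1)) ∞ D.φ.symm D.φ.target :=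
  D.contMDiffOn_φY_symm.comp D.contMDiff_ofB.contMDiffOn fun _ hc => D.mem_φ_target.1 hc

/-- **The gluing datum of the connected sum** `M # Y`: the punctured pieces `M ∖ {i 0}` and
`B = Y ∖ {j 0}` (recharted) glued along Kervaire–Milnor's identification of the punctured discs.
[cite: KervaireMilnorAnnals1963, §2] -/
def glueData : SmoothGlueData (𝓡∂ (m + 1)) (𝓡∂ (m + 1)) D.A D.B (𝔼 (m + 1)) :=
  ⟨D.φ, D.contMDiffOn_φ, D.contMDiffOn_φ_symm, ContinuousLinearEquiv.refl ℝ _,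
    ContinuousLinearEquiv.refl ℝ _⟩

/-- The gluing map of the gluing datum is `φ` (definitional). [folklore] -/
@[simp] theorem glueData_glue : D.glueData.glue = D.φ := rfl

/-- **The connected sum `M # Y`** along the interior discs `i`, `j`, as the glued `C^∞` manifold with
boundary `(M ∖ {i 0}) ∪_φ (Y ∖ {j 0})` (Kervaire–Milnor 1963, §2; Kosinski VI.1). [cite: KervaireMilnorAnnals1963, §2] -/
abbrev P : Type (max u v) := D.glueData.Glued

/-- **The gluing relation of `P` is Kervaire–Milnor's connected sum relation**:
`inl a = inr (toB b) ↔ connectedSumRel i j a b`. [cite: KervaireMilnorAnnals1963, §2] -/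
theorem inl_eq_inr_toB_iff (a : D.A) (b : D.BY) :
    D.glueData.inl a = D.glueData.inr (D.toB b) ↔ connectedSumRel D.i D.j a b := by
  rw [D.glueData.inl_eq_inr_iff, glueData_glue, D.connectedSumRel_iff_φ]

/-! ### Separation, compactness, countability -/

/-- The graph of the gluing map is closed. [cite: KervaireMilnorAnnals1963, §2] [cite: Kosinski1993, Ch. VI §1, (1.1)] -/
theorem isClosed_graph_φ : IsClosed {p : D.A × D.B | p.1 ∈ D.φ.source ∧ D.φ p.1 = p.2} := by
  have heq : {p : D.A × D.B | p.1 ∈ D.φ.source ∧ D.φ p.1 = p.2} =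
      (Prod.map id D.ofB) ⁻¹' {q : D.A × D.BY | connectedSumRel D.i D.j q.1 q.2} := by
    ext ⟨a, c⟩
    simp only [mem_setOf_eq, mem_preimage, Prod.map_apply, id_eq]
    rw [D.connectedSumRel_iff_φ, toB_ofB]
  rw [heq]
  exact D.isClosed_connectedSumRel.preimage (continuous_id.prodMap D.contMDiff_ofB.continuous)

/-- **`M # Y` is Hausdorff** (the graph of the gluing map is closed: the centres of the discs are
removed). [cite: Kosinski1993, Ch. VI §1, (1.1)] -/
instance t2Space_P : T2Space D.P := D.glueData.t2Space_of_isClosed_graph D.isClosed_graph_φ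

/-- The compact piece `M ∖ i (ball 0 ½)` of the first punctured piece. [cite: KervaireMilnorAnnals1963, §2] -/
def K₁ : Set D.A := Subtype.val ⁻¹' (D.i '' ball 0 2⁻¹)ᶜ

/-- The compact piece `Y ∖ j (ball 0 ½)` of the second punctured piece (in `B`). [cite: KervaireMilnorAnnals1963, §2] -/
def K₂ : Set D.B := D.ofB ⁻¹' (Subtype.val ⁻¹' (D.j '' ball 0 2⁻¹)ᶜ)

omit [FiniteDimensional ℝ EY] [IY.Boundaryless] [IsManifold IY ∞ Y] [T2Space Y] in
/-- `M ∖ i (ball 0 ½)` is compact when `M` is. [cite: KervaireMilnorAnnals1963, §2] -/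
theorem isCompact_K₁ [CompactSpace M] : IsCompact D.K₁ := by
  have ho : IsOpen (D.i '' ball 0 2⁻¹) := (isOpenEmbedding_disc' D.isSmoothEmbedding_i rfl).isOpenMap _ isOpen_ball
  have hsub : (D.i '' ball 0 2⁻¹)ᶜ ⊆ (D.A : Set M) := by
    intro p hp h
    rw [mem_singleton_iff] at h
    exact hp ⟨0, mem_ball_self (by norm_num), h.symm⟩
  have himg : Subtype.val '' D.K₁ = (D.i '' ball 0 2⁻¹)ᶜ := by
    ext p
    exact ⟨by rintro ⟨a, ha, rfl⟩; exact ha, fun hp => ⟨⟨p, hsub hp⟩, hp, rfl⟩⟩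
  rw [Subtype.isCompact_iff, himg]
  exact ho.isClosed_compl.isCompact

omit [T2Space M] in
/-- `Y ∖ j (ball 0 ½)` (in `B`) is compact when `Y` is. [cite: KervaireMilnorAnnals1963, §2] -/
theorem isCompact_K₂ [CompactSpace Y] : IsCompact D.K₂ := by
  have ho : IsOpen (D.j '' ball 0 2⁻¹) :=
    (isOpenEmbedding_disc' D.isSmoothEmbedding_j D.finrank_eq).isOpenMap _ isOpen_ball
  have hsub : (D.j '' ball 0 2⁻¹)ᶜ ⊆ (D.BY : Set Y) := by
    intro q hq h
    rw [mem_singleton_iff] at h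
    exact hq ⟨0, mem_ball_self (by norm_num), h.symm⟩
  set K : Set D.BY := Subtype.val ⁻¹' (D.j '' ball 0 2⁻¹)ᶜ with hK
  have himg : Subtype.val '' K = (D.j '' ball 0 2⁻¹)ᶜ := by
    ext q
    exact ⟨by rintro ⟨b, hb, rfl⟩; exact hb, fun hq => ⟨⟨q, hsub hq⟩, hq, rfl⟩⟩
  have hKc : IsCompact K := by
    rw [Subtype.isCompact_iff, himg]
    exact ho.isClosed_compl.isCompact
  have heq : D.K₂ = D.toB '' K := by
    ext c
    simp only [K₂, mem_preimage, mem_image]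
    constructor
    · intro hc
      exact ⟨D.ofB c, hc, D.toB_ofB c⟩
    · rintro ⟨b, hb, rfl⟩
      rwa [ofB_toB]
  rw [heq]
  exact hKc.image D.contMDiff_toB.continuous

/-- A point of the small punctured disc `i (ball 0 ½ ∖ 0)` is glued to a point outside
`j (ball 0 ½)`, since `‖ψ v‖ = 1 - ‖v‖`. [cite: KervaireMilnorAnnals1963, §2] -/
theorem φ_mem_K₂ {a : D.A} (ha : a ∉ D.K₁) : a ∈ D.φ.source ∧ D.φ a ∈ D.K₂ := by
  simp only [K₁, mem_preimage, mem_compl_iff, not_not] at ha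
  obtain ⟨v, hv, hva⟩ := ha
  rw [mem_ball_zero_iff] at hv
  have hv0 : v ≠ 0 := by
    rintro rfl
    exact a.2 (mem_singleton_iff.2 hva.symm)
  have hvn : 0 < ‖v‖ := norm_pos_iff.2 hv0
  have hea : D.e₁ a = v := by rw [← hva, D.e₁_i]
  have hsrc : (a : M) ∈ D.Φ.source :=
    D.mem_Φ_source.2 ⟨⟨v, hva⟩, by rw [hea]; exact hvn, by rw [hea]; linarith⟩
  have hsrc' : a ∈ D.φ.source := by rw [φ_source, mem_φY_source]; exact hsrc
  refine ⟨hsrc', ?_⟩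
  simp only [K₂, mem_preimage, mem_compl_iff, φ_apply, ofB_toB]
  rw [D.coe_φY (D.mem_φY_source.2 hsrc), Φ_apply, hea]
  rintro ⟨w, hw, hwe⟩
  rw [mem_ball_zero_iff] at hw
  have h1 : w = discInversionFun v := D.injective_j hwe
  have h2 : ‖discInversionFun v‖ = 1 - ‖v‖ := norm_discInversionFun hv0 (by linarith)
  rw [h1, h2] at hw
  linarith

/-- A point of the small punctured disc `j (ball 0 ½ ∖ 0)` is glued to a point outside
`i (ball 0 ½)`. [cite: KervaireMilnorAnnals1963, §2] -/
theorem φ_symm_mem_K₁ {c : D.B} (hc : c ∉ D.K₂) : c ∈ D.φ.target ∧ D.φ.symm c ∈ D.K₁ := by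
  simp only [K₂, mem_preimage, mem_compl_iff, not_not] at hc
  obtain ⟨v, hv, hvc⟩ := hc
  rw [mem_ball_zero_iff] at hv
  have hv0 : v ≠ 0 := by
    rintro rfl
    exact (D.ofB c).2 (mem_singleton_iff.2 hvc.symm)
  have hvn : 0 < ‖v‖ := norm_pos_iff.2 hv0
  have hec : D.e₂ (D.ofB c : Y) = v := by rw [← hvc, D.e₂_j]
  have htgt : ((D.ofB c : D.BY) : Y) ∈ D.Φ.target :=
    D.mem_Φ_target.2 ⟨⟨v, hvc⟩, by rw [hec]; exact hvn, by rw [hec]; linarith⟩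
  have htgt' : c ∈ D.φ.target := by rw [mem_φ_target, mem_φY_target]; exact htgt
  refine ⟨htgt', ?_⟩
  simp only [K₁, mem_preimage, mem_compl_iff, φ_symm_apply]
  rw [D.coe_φY_symm (D.mem_φY_target.2 htgt), Φ_symm_apply, hec]
  rintro ⟨w, hw, hwe⟩
  rw [mem_ball_zero_iff] at hw
  have h1 : w = discInversionFun v := D.injective_i hwe
  have h2 : ‖discInversionFun v‖ = 1 - ‖v‖ := norm_discInversionFun hv0 (by linarith)
  rw [h1, h2] at hw
  linarith

/-- **`M # Y` is compact** when `M` and `Y` are: it is covered by the images of the compact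
pieces `M ∖ i (ball 0 ½)` and `Y ∖ j (ball 0 ½)`. [cite: KervaireMilnorAnnals1963, §2] -/
instance compactSpace_P [CompactSpace M] [CompactSpace Y] : CompactSpace D.P :=
  D.glueData.compactSpace_of_forall_not_mem D.isCompact_K₁ D.isCompact_K₂
    (fun _ ha => D.φ_mem_K₂ ha) fun _ hc => D.φ_symm_mem_K₁ hc

/-- `M # Y` is second countable when `M` and `Y` are compact. [folklore] -/
instance secondCountableTopology_P [IsManifold (𝓡∂ (m + 1)) ∞ M] [CompactSpace M] [CompactSpace Y] :
    SecondCountableTopology D.P :=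
  D.glueData.secondCountableTopologyH

end Rechart


/-! ### `P` is a connected sum of `M` and `Y` -/

section ConnectedSum

variable [IY.Boundaryless] [IsManifold IY ∞ Y] [IsManifold (𝓡∂ (m + 1)) ∞ M]

/-- The second gluing embedding `Y ∖ {j 0} → M # Y` (with the charts of `Y` on the source). [cite: KervaireMilnorAnnals1963, §2] -/
def inrY : D.BY → D.P := D.glueData.inr ∘ D.toB

omit [IsManifold (𝓡∂ (m + 1)) ∞ M] in
/-- `inrY = inr ∘ toB` (definitional). [folklore] -/
theorem inrY_apply (b : D.BY) : D.inrY b = D.glueData.inr (D.toB b) := rfl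

/-- **The first piece `M ∖ {i 0} → M # Y` is a smooth embedding.** [cite: Kosinski1993, Ch. VI §1, Thm (1.1)] -/
theorem isSmoothEmbedding_inl :
    Manifold.IsSmoothEmbedding (𝓡∂ (m + 1)) (𝓡∂ (m + 1)) ∞ D.glueData.inl :=
  D.glueData.isSmoothEmbedding_inlH

/-- **The second piece `Y ∖ {j 0} → M # Y` is a smooth embedding** (models `IY`, `𝓡∂ (m + 1)`).
[cite: Kosinski1993, Ch. VI §1, Thm (1.1)] -/
theorem isSmoothEmbedding_inrY : Manifold.IsSmoothEmbedding IY (𝓡∂ (m + 1)) ∞ D.inrY :=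
  D.glueData.isSmoothEmbedding_inr_compH D.isSmoothEmbedding_toB

omit [IsManifold (𝓡∂ (m + 1)) ∞ M] in
/-- The range of the second piece is open. [folklore] -/
theorem isOpen_range_inrY : IsOpen (range D.inrY) := by
  rw [inrY, range_comp, D.surjective_toB.range_eq, image_univ]
  exact D.glueData.isOpen_range_inr

omit [IsManifold (𝓡∂ (m + 1)) ∞ M] in
/-- The two pieces cover `M # Y`. [folklore] -/
theorem range_inl_union_range_inrY : range D.glueData.inl ∪ range D.inrY = univ := by
  rw [inrY, range_comp, D.surjective_toB.range_eq, image_univ]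
  exact D.glueData.range_inl_union_range_inr

/-- **`M # Y` is an open gluing of the punctured pieces along Kervaire–Milnor's relation**, with the
explicit gluing embeddings `inl`, `inrY`. [cite: KervaireMilnorAnnals1963, §2] -/
theorem isOpenGluingWith :
    IsOpenGluingWith (𝓡∂ (m + 1)) IY (𝓡∂ (m + 1)) (A := D.A) (B := D.BY) (connectedSumRel D.i D.j)
      D.glueData.inl D.inrY :=
  ⟨D.isSmoothEmbedding_inl, D.glueData.isOpen_range_inl, D.isSmoothEmbedding_inrY, D.isOpen_range_inrY,
    D.range_inl_union_range_inrY, fun a b => D.inl_eq_inr_toB_iff a b⟩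

/-- **`P` is a connected sum `M # Y`** in the tree's relational sense
(`Literature.Topology.FourManifolds.IsConnectedSum`, models `𝓡∂ (m + 1)`, `𝓡∂ (m + 1)`, `IY`), with
discs `i`, `j`. [cite: KervaireMilnorAnnals1963, §2] [cite: Kosinski1993, Ch. VI §1, Thm (1.1)] -/
theorem isConnectedSum : IsConnectedSum (𝓡∂ (m + 1)) (𝓡∂ (m + 1)) IY M Y D.P :=
  ⟨D.i, D.j, D.isSmoothEmbedding_i, D.isSmoothEmbedding_j, D.glueData.inl, D.inrY, D.isOpenGluingWith⟩

/-! ### The boundary of `M # Y` is that of `M` -/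

omit [FiniteDimensional ℝ EY] [T2Space Y] [IY.Boundaryless] [IsManifold IY ∞ Y]
  [IsManifold (𝓡∂ (m + 1)) ∞ M] in
/-- A point of the first piece is a boundary point iff it is a boundary point of `M`. [folklore] -/
theorem isBoundaryPoint_A_iff (a : D.A) :
    (𝓡∂ (m + 1)).IsBoundaryPoint a ↔ (a : M) ∈ (𝓡∂ (m + 1)).boundary M :=
  (𝓡∂ (m + 1)).isBoundaryPoint_iff_isBoundaryPoint_val

/-- **The boundary of `M # Y` is the image of the boundary of `M`** (the second piece has no
boundary). [cite: KervaireMilnorAnnals1963, §2] -/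
theorem boundary_P_eq :
    (𝓡∂ (m + 1)).boundary D.P = D.glueData.inl '' {a : D.A | (a : M) ∈ (𝓡∂ (m + 1)).boundary M} := by
  have hA : (𝓡∂ (m + 1)).boundary D.A = {a : D.A | (a : M) ∈ (𝓡∂ (m + 1)).boundary M} :=
    Set.ext fun a => D.isBoundaryPoint_A_iff a
  have hB : (𝓡∂ (m + 1)).boundary D.B = ∅ := HalfSpaceCharted.boundary_eq_empty
  rw [D.glueData.boundary_glued_eq, hA, hB, image_empty, union_empty]

omit [FiniteDimensional ℝ EY] [T2Space M] [T2Space Y] [IY.Boundaryless] [IsManifold IY ∞ Y] in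
/-- The boundary of `M` misses the centre of the disc `i` (a disc lies in the interior). [folklore] -/
theorem ne_center_of_mem_boundary {p : M} (hp : p ∈ (𝓡∂ (m + 1)).boundary M) : p ≠ D.i 0 := by
  rintro rfl
  have hint : (𝓡∂ (m + 1)).IsInteriorPoint (D.i 0) :=
    isInteriorPoint_of_isSmoothEmbedding_disc D.isSmoothEmbedding_i 0
  exact ((𝓡∂ (m + 1)).isInteriorPoint_iff_not_isBoundaryPoint (D.i 0)).1 hint hp

end ConnectedSum

end InteriorSumData

/-! ### The boundary datum of `M # Y` -/

namespace InteriorSumData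

variable {m : ℕ} {M : Type u} [TopologicalSpace M] [ChartedSpace (ℍ (m + 1)) M]
  {EY HY : Type*} [NormedAddCommGroup EY] [NormedSpace ℝ EY] [TopologicalSpace HY]
  {IY : ModelWithCorners ℝ EY HY} {Y : Type u} [TopologicalSpace Y] [ChartedSpace HY Y]
  [FiniteDimensional ℝ EY] [T2Space M] [T2Space Y] [IY.Boundaryless] [IsManifold IY ∞ Y]
  [IsManifold (𝓡∂ (m + 1)) ∞ M]
  (D : InteriorSumData m M IY Y) (b : BoundaryData (𝓡∂ (m + 1)) M (𝓡 m))

omit [FiniteDimensional ℝ EY] [T2Space M] [T2Space Y] [IY.Boundaryless] [IsManifold IY ∞ Y] in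
/-- The boundary inclusion of `M` misses the centre of the disc. [folklore] -/
theorem incl_ne_center (z : b.carrier) : b.incl z ≠ D.i 0 :=
  D.ne_center_of_mem_boundary (b.incl_mem_boundary z)

/-- The boundary inclusion of `M` as a map into the first piece `M ∖ {i 0}`. [folklore] -/
def inclA (z : b.carrier) : D.A := ⟨b.incl z, D.incl_ne_center b z⟩

omit [FiniteDimensional ℝ EY] [T2Space Y] [IY.Boundaryless] [IsManifold IY ∞ Y] in
/-- The underlying point of `inclA z` is `incl z` (definitional). [folklore] -/
@[simp] theorem coe_inclA (z : b.carrier) : (D.inclA b z : M) = b.incl z := rfl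

omit [FiniteDimensional ℝ EY] [T2Space Y] [IY.Boundaryless] [IsManifold IY ∞ Y] in
/-- `inclA` is a smooth embedding (corestriction of `incl` to an open submanifold). [folklore] -/
theorem isSmoothEmbedding_inclA : Manifold.IsSmoothEmbedding (𝓡 m) (𝓡∂ (m + 1)) ∞ (D.inclA b) :=
  b.isSmoothEmbedding.codRestrict_opens D.A (D.incl_ne_center b)

/-- **The boundary datum of `M # Y`**: `∂(M # Y) = ∂M`, with the same carrier as the given boundary
datum `b` of `M` and inclusion `inl ∘ incl` (for `M`, `Y` in a common universe, as the carrier of a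
boundary datum lives in the universe of the manifold). [cite: KervaireMilnorAnnals1963, §2] -/
def boundaryData : BoundaryData (𝓡∂ (m + 1)) D.P (𝓡 m) where
  carrier := b.carrier
  incl := D.glueData.inl ∘ D.inclA b
  isSmoothEmbedding := D.glueData.isSmoothEmbedding_inl_compH (D.isSmoothEmbedding_inclA b)
  range_incl := by
    rw [D.boundary_P_eq, range_comp]
    congr 1
    ext a
    constructor
    · rintro ⟨z, rfl⟩
      exact b.incl_mem_boundary z
    · intro ha
      rw [mem_setOf_eq, ← b.range_incl] at ha
      obtain ⟨z, hz⟩ := ha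
      exact ⟨z, Subtype.ext hz⟩

/-- The carrier of the boundary datum of `M # Y` is that of `b` (definitional). [folklore] -/
@[simp] theorem boundaryData_carrier : (D.boundaryData b).carrier = b.carrier := rfl

/-- The inclusion of the boundary datum of `M # Y` is `inl ∘ incl` (definitional). [folklore] -/
@[simp] theorem boundaryData_incl (z : b.carrier) :
    (D.boundaryData b).incl z = D.glueData.inl (D.inclA b z) := rfl

end InteriorSumData

end Literature.Topology.FourManifolds
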